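import Literature.Computability.AlgebraicComplexity.CircuitGateSemantics
import Mathlib.RingTheory.MvPolynomial.Homogeneous

/-!
# Degree of an unbounded fan-in circuit: `deg ≤ s^Δ` for fan-in `≤ s` and product-depth `Δ`

The standard degree bound behind the hypothesis "`char F > s^Δ`" of Andrews–Forbes 2022, Lemma 6.7
(p0034:L6: a circuit of size `s` and product-depth `Δ` computes a polynomial "of degree at most
`s^Δ`"; size = wires, so every product gate has fan-in `≤ s`), for the tree's list-presented
`ArithCircuit` (weighted-sum and product gates of unbounded fan-in) and its gate semantics
(`CircuitGateSemantics.lean`: `gateVal`, `opVal`, `gatePD`, `opPD`):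

* `ArithCircuit.totalDegree_gateVal_le` — if every gate has fan-in `≤ s` (`s ≥ 1`), the value of
  gate `i` has total degree `≤ s^{gatePD i}` (strong induction on `i`: a sum gate does not raise the
  bound, a product gate of fan-in `≤ s` multiplies at most `s` operands of product-depth one less);
* `ArithCircuit.totalDegree_eval_le` — hence `deg P.eval ≤ s^Δ` for product-depth `≤ Δ`;
* `ArithCircuit.totalDegree_eval_le_edgeSize_pow` — the wire-size form (`fanIn ≤ edgeSize ≤ s`).

Theorem-only; no new definitions or named facts.

## References
* [AndrewsForbes2022] R. Andrews, M. A. Forbes, *Ideals, determinants, and straightening*, STOC 2022,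
  arXiv:2112.00792 — proof of Lemma 6.7 (p0034:L6).
* [LimayeSrinivasanTavenas2025] N. Limaye, S. Srinivasan, S. Tavenas, J. ACM 2025 — §2 (size and
  product-depth conventions).
-/

noncomputable section

open MvPolynomial

namespace Literature.Computability.AlgebraicComplexity

universe u v

namespace ArithCircuit

variable {k : Type u} [CommSemiring k] {σ : Type v}

/-- Total degree of a list sum under a uniform bound. [folklore] -/
private theorem totalDegree_list_sum_le_af {n : ℕ} (l : List (MvPolynomial σ k))
    (h : ∀ p ∈ l, p.totalDegree ≤ n) : l.sum.totalDegree ≤ n := by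
  induction l with
  | nil => simp
  | cons a l ih =>
    rw [List.sum_cons]
    exact (totalDegree_add a l.sum).trans (max_le (h a (by simp)) (ih fun p hp => h p (by simp [hp])))

/-- **Degree versus product-depth**: if every gate of `P` has fan-in `≤ s` (`s ≥ 1`), the value of
a gate of product-depth `p` has total degree `≤ s^p`, and the value of an operand as seen by gate
`i` has total degree `≤ s^{opPD}` (LST 2021 §1: a product-depth-`Δ` formula of size `s` has degree
`≤ s^Δ`; Andrews–Forbes 2022, proof of Lemma 6.7, p0034:L6). [cite: AndrewsForbes2022, Lemma 6.7 (proof)] -/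
theorem totalDegree_gateVal_le (P : ArithCircuit k σ) {s : ℕ} (h1 : 1 ≤ s)
    (hs : ∀ g ∈ P.gates, g.fanIn ≤ s) :
    ∀ i, (P.gateVal i).totalDegree ≤ s ^ P.gatePD i := by
  intro i
  induction i using Nat.strong_induction_on with
  | _ i ih =>
    -- operands seen by gate `i`
    have hop : ∀ u : Operand k σ, (P.opVal i u).totalDegree ≤ s ^ P.opPD i u := by
      intro u
      cases u with
      | var v => simpa using (isHomogeneous_X k v).totalDegree_le
      | const c => simp
      | gate j =>
        simp only [opVal_gate, opPD_gate]
        split_ifs with hj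
        · exact ih j hj
        · simp
    by_cases hi : i < P.size
    · obtain ⟨g, hg⟩ : ∃ g, P.gates[i]? = some g := ⟨P.gates[i], List.getElem?_eq_getElem hi⟩
      have hgmem : g ∈ P.gates := List.mem_of_getElem? hg
      cases g with
      | sum args =>
        rw [P.gateVal_of_sum hg]
        refine totalDegree_list_sum_le_af _ fun p hp => ?_
        obtain ⟨a, ha, rfl⟩ := List.mem_map.1 hp
        refine (totalDegree_smul_le _ _).trans ((hop a.2).trans ?_)
        exact Nat.pow_le_pow_right h1 (P.opPD_le_gatePD_of_sum hg ha)
      | prod args =>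
        rw [P.gateVal_of_prod hg]
        refine (totalDegree_list_prod _).trans ?_
        rw [List.map_map]
        have hlen : args.length ≤ s := by
          have := hs _ hgmem
          simpa [Gate.fanIn, Gate.args] using this
        have hpd : 1 ≤ P.gatePD i := by
          rcases args with _ | ⟨u, us⟩
          · unfold gatePD
            rw [List.getD_eq_getElem?_getD, gateWDepths_getElem? prodWeight P.gates i _ hg,
              Option.getD_some]
            simp [prodWeight, Gate.isProd]
          · have := P.opPD_succ_le_gatePD_of_prod hg (u := u) (by simp)
            omega
        calc (args.map (totalDegree ∘ P.opVal i)).sum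
            ≤ (args.map fun _ => s ^ (P.gatePD i - 1)).sum := by
              refine List.sum_le_sum fun u hu => ?_
              refine (hop u).trans (Nat.pow_le_pow_right h1 ?_)
              have := P.opPD_succ_le_gatePD_of_prod hg hu
              omega
          _ = args.length * s ^ (P.gatePD i - 1) := by simp
          _ ≤ s * s ^ (P.gatePD i - 1) := Nat.mul_le_mul_right _ hlen
          _ = s ^ P.gatePD i := by
              rw [← pow_succ']
              congr 1
              omega
    · rw [P.gateVal_of_le (not_lt.1 hi)]
      simp

/-- **Degree `≤ s^Δ`**: a circuit of product-depth `≤ Δ` all of whose gates have fan-in `≤ s`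
(`s ≥ 1`) computes a polynomial of total degree `≤ s^Δ`. [cite: AndrewsForbes2022, Lemma 6.7 (proof)] -/
theorem totalDegree_eval_le (P : ArithCircuit k σ) {s Δ : ℕ} (h1 : 1 ≤ s)
    (hs : ∀ g ∈ P.gates, g.fanIn ≤ s) (hΔ : P.productDepth ≤ Δ) :
    P.eval.totalDegree ≤ s ^ Δ := by
  rw [P.eval_eq_opVal_output]
  have hop : (P.opVal P.size P.output).totalDegree ≤ s ^ P.opPD P.size P.output := by
    cases h : P.output with
    | var v => simpa using (isHomogeneous_X k v).totalDegree_le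
    | const c => simp
    | gate j =>
      simp only [opVal_gate, opPD_gate]
      split_ifs with hj
      · exact totalDegree_gateVal_le P h1 hs j
      · simp
  refine hop.trans (Nat.pow_le_pow_right h1 ?_)
  rw [← P.productDepth_eq_opPD_output]
  exact hΔ

omit [CommSemiring k] in
/-- Every gate's fan-in is at most the number of wires (size = wires, LST §2). [cite: LimayeSrinivasanTavenas2025, §2] -/
theorem fanIn_le_edgeSize_of_mem (P : ArithCircuit k σ) {g : Gate k σ} (hg : g ∈ P.gates) :
    g.fanIn ≤ P.edgeSize := by
  unfold edgeSize
  exact List.single_le_sum (fun _ _ => Nat.zero_le _) _ (List.mem_map.2 ⟨g, hg, rfl⟩)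

/-- **Degree `≤ s^Δ` for wire-size `s`** (Andrews–Forbes 2022, proof of Lemma 6.7: "a circuit of
size `s` and product-depth `Δ` computes a polynomial of degree at most `s^Δ`", with size = wires):
a circuit of product-depth `≤ Δ` with at most `s ≥ 1` wires computes a polynomial of total degree
`≤ s^Δ`. [cite: AndrewsForbes2022, Lemma 6.7 (proof)] -/
theorem totalDegree_eval_le_edgeSize_pow (P : ArithCircuit k σ) {s Δ : ℕ} (h1 : 1 ≤ s)
    (hs : P.edgeSize ≤ s) (hΔ : P.productDepth ≤ Δ) : P.eval.totalDegree ≤ s ^ Δ :=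
  P.totalDegree_eval_le h1 (fun _ hg => (P.fanIn_le_edgeSize_of_mem hg).trans hs) hΔ

end ArithCircuit

end Literature.Computability.AlgebraicComplexity
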